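import Mathlib
import Summits.NavierStokesRegularity.NavierStokesRegularity.Theorems.PowerGaugeEulerLiouville.Negative.IntegrableVorticityNotRelaxing
import Summits.NavierStokesRegularity.NavierStokesRegularity.Theorems.PowerGaugeEulerLiouville.Negative.AncientFlowFatVorticity

/-!
# Crux `EulerZoomLiouville.PowerGaugeEulerLiouville` (stmt-NavierStokesRegularity-19832) —
# the ANCIENT door (A) has no member with an energy floor and ONE integrable-vorticity slice

Negative-lane structure record (prover hand leafhand-ns-eulerzoomliouville-9 g0; `--supports` stmt-19832).  Time-reflected twin of
`…Negative.IntegrableVorticityNotRelaxing`: door (A) of `…Negative.BudgetedClassicalAncientFlow` (a nonzero classical ancient Euler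
flow on `(−∞,0) × ℝ³` with finite global budgets, among them the space–time enstrophy `∫∫_{(−∞,0)×ℝ³}|∇u|²_F < ∞`) was shown by
hand 8 to have FAT vorticity (`…Negative.AncientFlowFatVorticity`, slicewise kinematics).  The `L¹` law is dynamical, so its ancient
form is obtained by reflecting time about a slice `T₁ < 0`: `v(s,x) = −u(T₁ − s, x)` is a classical Euler flow on `(T₁,∞) ⊇ [0,∞)`
(`isClassicalEulerSolutionOn_timeReflection`), with the Cauchy–Lipschitz hypotheses (`isUniformlyLipschitzOn_timeReflection`), initial
vorticity `−curl u(T₁)` and forward enstrophy budget equal to the budget of `u` on `(−∞,T₁)` (`setLIntegral_timeReflection`).  Hence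

* `no_budgetedAncient_classicalEuler_of_integrableVorticitySlice` — a classical ancient Euler flow on `(−∞,0) × ℝ³` with
  Cauchy–Lipschitz velocity, the `L² ∩ L³ / |p||u|` slice budgets on compact sub-intervals (energy conservation), positive energy at
  one time, finite-enstrophy slices and ONE slice `T₁ < 0` with `curl u(T₁) ∈ L¹(ℝ³)` has `∫∫_{(−∞,0)×ℝ³}|∇u|²_F = ∞`.

Consistency check with the line: exactly self-similar collapse members (`|∇V(y)| ~ |y|^{−2−ρ}`) have `|ω(T₁,x)| ~ |x|^{−2−ρ} ∉ L¹` on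
every slice, as they must.  WHAT THIS IS NOT: not a refutation or proof of the crux, of a stub, or of the route; not a claim about
Navier–Stokes. [folklore] -/

noncomputable section
set_option linter.dupNamespace false
namespace Summit.NavierStokesRegularity.NavierStokesRegularity.Theorems.PowerGaugeEulerLiouville.Negative

open MeasureTheory Set Function Filter Topology Metric Literature.Analysis Literature.Analysis.FluidPDE
open scoped NNReal ENNReal

/-- **Time reflection about a slice.**  If `(u,p)` is a classical Euler flow on `(−∞,0) × ℝ³` then, for every `c`,
`v(s,x) = −u(c − s, x)`, `q(s,x) = p(c − s, x)` is a classical Euler flow on `(c,∞) × ℝ³` (the preimage of `(−∞,0)` under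
`s ↦ c − s`). [folklore] -/
theorem isClassicalEulerSolutionOn_timeReflection
    {u : ℝ → EuclideanSpace ℝ (Fin 3) → EuclideanSpace ℝ (Fin 3)} {p : ℝ → EuclideanSpace ℝ (Fin 3) → ℝ}
    (hsol : IsClassicalEulerSolutionOn (Iio (0 : ℝ)) 0 u p) (c : ℝ) :
    IsClassicalEulerSolutionOn (Ioi c) 0 (fun s x => -u (c - s) x) (fun s x => p (c - s) x) := by
  have hR : ContDiff ℝ (⊤ : ℕ∞)
      (fun z : ℝ × EuclideanSpace ℝ (Fin 3) => ((c - z.1, z.2) : ℝ × EuclideanSpace ℝ (Fin 3))) :=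
    (contDiff_const.sub contDiff_fst).prodMk contDiff_snd
  have hmaps : MapsTo (fun z : ℝ × EuclideanSpace ℝ (Fin 3) => ((c - z.1, z.2) : ℝ × EuclideanSpace ℝ (Fin 3)))
      (Ioi c ×ˢ (univ : Set (EuclideanSpace ℝ (Fin 3)))) (Iio (0 : ℝ) ×ˢ (univ : Set (EuclideanSpace ℝ (Fin 3)))) :=
    fun z hz => show ((c - z.1, z.2) : ℝ × EuclideanSpace ℝ (Fin 3)) ∈ Iio (0 : ℝ) ×ˢ (univ : Set (EuclideanSpace ℝ (Fin 3)))
      from ⟨sub_neg.mpr (show c < z.1 from hz.1), mem_univ _⟩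
  have hu : ContDiffOn ℝ (⊤ : ℕ∞) (uncurry u) (Iio (0 : ℝ) ×ˢ (univ : Set (EuclideanSpace ℝ (Fin 3)))) :=
    hsol.smooth_velocity
  have hp : ContDiffOn ℝ (⊤ : ℕ∞) (uncurry p) (Iio (0 : ℝ) ×ˢ (univ : Set (EuclideanSpace ℝ (Fin 3)))) :=
    hsol.smooth_pressure
  refine ⟨?_, ?_, ?_, ?_⟩
  · show ContDiffOn ℝ (⊤ : ℕ∞) (fun z : ℝ × EuclideanSpace ℝ (Fin 3) => -(uncurry u (c - z.1, z.2)))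
      (Ioi c ×ˢ (univ : Set (EuclideanSpace ℝ (Fin 3))))
    exact (hu.comp hR.contDiffOn hmaps).neg
  · show ContDiffOn ℝ (⊤ : ℕ∞) (fun z : ℝ × EuclideanSpace ℝ (Fin 3) => uncurry p (c - z.1, z.2))
      (Ioi c ×ˢ (univ : Set (EuclideanSpace ℝ (Fin 3))))
    exact hp.comp hR.contDiffOn hmaps
  · intro t ht x
    have ht' : c - t ∈ Iio (0 : ℝ) := mem_Iio.mpr (sub_neg.mpr ht)
    have h1 : timeDerivWithin (Ioi c) (fun t x => -u (c - t) x) t x = timeDeriv (fun t x => -u (c - t) x) t x :=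
      timeDerivWithin_of_mem_interior (by rwa [interior_Ioi]) x
    have h2 : timeDerivWithin (Iio (0 : ℝ)) u (c - t) x = timeDeriv u (c - t) x :=
      timeDerivWithin_of_mem_interior (by rwa [interior_Iio]) x
    have h3 : timeDeriv (fun t x => -u (c - t) x) t x = timeDeriv u (c - t) x := by
      simp only [timeDeriv_apply]
      rw [deriv.fun_neg, deriv_comp_const_sub (fun s => u s x) c t, neg_neg]
    have h4 : convect (fun y => -u (c - t) y) (fun y => -u (c - t) y) x = convect (u (c - t)) (u (c - t)) x := by
      rw [convect_apply, convect_apply, fderiv_fun_neg, neg_apply, map_neg, neg_neg]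
    have hm := hsol.momentum (c - t) ht' x
    rw [h2] at hm
    simp only [zero_smul, Pi.zero_apply, add_zero, zero_sub] at hm ⊢
    rw [h1, h3, h4, hm]
  · intro t ht
    exact isDivFree_neg_field (hsol.divFree (c - t) (mem_Iio.mpr (sub_neg.mpr ht)))

/-- **The Cauchy–Lipschitz hypotheses survive the time reflection** (restricted to `[0,∞)` when `c < 0`). [folklore] -/
theorem isUniformlyLipschitzOn_timeReflection
    {u : ℝ → EuclideanSpace ℝ (Fin 3) → EuclideanSpace ℝ (Fin 3)}
    (hL : ODE.IsUniformlyLipschitzOn u (Iio (0 : ℝ))) {c : ℝ} (hc : c < 0) :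
    ODE.IsUniformlyLipschitzOn (fun s x => -u (c - s) x) (Ici (0 : ℝ)) := by
  have hmaps : MapsTo (fun s : ℝ => c - s) (Ici (0 : ℝ)) (Iio (0 : ℝ)) := fun s hs =>
    mem_Iio.2 (by linarith [mem_Ici.1 hs])
  refine ⟨fun x => ?_, fun C hC hCS => ?_⟩
  · exact ((hL.continuousOn x).comp (continuous_const.sub continuous_id).continuousOn hmaps).neg
  · have hC' : IsCompact ((fun s : ℝ => c - s) '' C) := hC.image (continuous_const.sub continuous_id)
    have hC'S : (fun s : ℝ => c - s) '' C ⊆ Iio (0 : ℝ) := by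
      rintro _ ⟨s, hs, rfl⟩
      exact hmaps (hCS hs)
    obtain ⟨K, hK⟩ := hL.exists_lipschitzWith hC' hC'S
    exact ⟨K, fun s hs => (hK (c - s) ⟨s, hs, rfl⟩).neg⟩

/-- **Lebesgue measure on `ℝ × ℝ³` is invariant under the time reflection `(s,x) ↦ (c − s, x)`**: substitution rule for lower
integrals, `(0,∞) × ℝ³ ↔ (−∞,c) × ℝ³` (no measurability needed). [folklore] -/
theorem setLIntegral_timeReflection (c : ℝ) (F : ℝ × EuclideanSpace ℝ (Fin 3) → ℝ≥0∞) :
    ∫⁻ z in Ioi (0 : ℝ) ×ˢ (univ : Set (EuclideanSpace ℝ (Fin 3))), F (c - z.1, z.2) =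
      ∫⁻ w in Iio c ×ˢ (univ : Set (EuclideanSpace ℝ (Fin 3))), F w := by
  set e : ℝ × EuclideanSpace ℝ (Fin 3) ≃ᵐ ℝ × EuclideanSpace ℝ (Fin 3) :=
    (MeasurableEquiv.subLeft c).prodCongr (MeasurableEquiv.refl (EuclideanSpace ℝ (Fin 3))) with he
  have hecoe : ∀ z : ℝ × EuclideanSpace ℝ (Fin 3), e z = (c - z.1, z.2) := fun z => rfl
  have hmp : MeasurePreserving e (volume : Measure (ℝ × EuclideanSpace ℝ (Fin 3))) volume := by
    rw [Measure.volume_eq_prod]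
    exact (Measure.measurePreserving_sub_left (volume : Measure ℝ) c).prod
      (MeasurePreserving.id (volume : Measure (EuclideanSpace ℝ (Fin 3))))
  have hpre : e ⁻¹' (Iio c ×ˢ (univ : Set (EuclideanSpace ℝ (Fin 3)))) =
      Ioi (0 : ℝ) ×ˢ (univ : Set (EuclideanSpace ℝ (Fin 3))) := by
    ext z
    simp only [mem_preimage, hecoe, mem_prod, mem_Ioi, mem_Iio, mem_univ, and_true, sub_lt_self_iff]
  have h := hmp.setLIntegral_comp_preimage_emb e.measurableEmbedding F
    (Iio c ×ˢ (univ : Set (EuclideanSpace ℝ (Fin 3))))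
  rw [hpre] at h
  simpa only [hecoe] using h

/-- **NO BUDGETED ANCIENT CLASSICAL EULER FLOW HAS AN INTEGRABLE-VORTICITY SLICE.**  Let `(u,p)` be a classical Euler flow on
`(−∞,0) × ℝ³` with Cauchy–Lipschitz velocity (`ODE.IsUniformlyLipschitzOn u (Iio 0)`), slices with `∫|u|², ∫|u|³, ∫|p||u|` bounded
on every compact sub-interval of `(−∞,0)` (energy conservation), positive energy at some time `t₀`, finite-enstrophy slices, and ONE
slice `T₁ ∈ (t₀, 0)` with integrable vorticity `∫‖curl u(T₁)‖ < ∞`.  Then the ancient space–time enstrophy budget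
`∫∫_{(−∞,0)×ℝ³}|∇u|²_F ≤ M` fails for every `M` — the time reflection `s ↦ −u(T₁ − s)` would be a relaxing forward flow with
integrable initial vorticity (`no_relaxing_classicalEuler_of_integrableVorticity`).  Door (A) members with an energy floor therefore
have NON-INTEGRABLE vorticity on every slice. [folklore] -/
theorem no_budgetedAncient_classicalEuler_of_integrableVorticitySlice
    {u : ℝ → EuclideanSpace ℝ (Fin 3) → EuclideanSpace ℝ (Fin 3)} {p : ℝ → EuclideanSpace ℝ (Fin 3) → ℝ} {M : ℝ≥0}
    (h : IsClassicalEulerSolutionOn (Iio (0 : ℝ)) 0 u p) (hL : ODE.IsUniformlyLipschitzOn u (Iio (0 : ℝ)))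
    {T₁ : ℝ} (hT₁ : T₁ < 0) (hω₁ : ∫⁻ x, ‖curl (u T₁) x‖ₑ < ⊤)
    (hunif : ∀ a b : ℝ, a < b → b < 0 → ∃ M' : ℝ, ∀ τ ∈ Icc a b,
      (Integrable (fun y => ‖u τ y‖ ^ 2) ∧ ∫ y, ‖u τ y‖ ^ 2 ≤ M') ∧
      (Integrable (fun y => ‖u τ y‖ ^ 3) ∧ ∫ y, ‖u τ y‖ ^ 3 ≤ M') ∧
      (Integrable (fun y => |p τ y| * ‖u τ y‖) ∧ ∫ y, |p τ y| * ‖u τ y‖ ≤ M'))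
    {t₀ : ℝ} (ht₀ : t₀ < T₁) (hpos : 0 < ∫ y, ‖u t₀ y‖ ^ 2)
    (hωfin : ∀ t : ℝ, t < 0 → ∫⁻ x, ‖curl (u t) x‖ₑ ^ 2 < ⊤)
    (hEns : ∫⁻ z in Iio (0 : ℝ) ×ˢ (univ : Set (EuclideanSpace ℝ (Fin 3))),
      ENNReal.ofReal (frobeniusNormSq (fderiv ℝ (u z.1) z.2)) ≤ (M : ℝ≥0∞)) : False := by
  have hfrob : ∀ A : EuclideanSpace ℝ (Fin 3) →L[ℝ] EuclideanSpace ℝ (Fin 3),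
      frobeniusNormSq (-A) = frobeniusNormSq A := fun A => by
    simp [frobeniusNormSq]
  -- the reflected forward flow
  set v : ℝ → EuclideanSpace ℝ (Fin 3) → EuclideanSpace ℝ (Fin 3) := fun s x => -u (T₁ - s) x with hvdef
  set q : ℝ → EuclideanSpace ℝ (Fin 3) → ℝ := fun s x => p (T₁ - s) x with hqdef
  have hv : IsClassicalEulerSolutionOn (Ici (0 : ℝ)) 0 v q :=
    (isClassicalEulerSolutionOn_timeReflection h T₁).mono (fun s hs => lt_of_lt_of_le hT₁ (mem_Ici.1 hs))
      (uniqueDiffOn_Ici 0)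
  have hLv : ODE.IsUniformlyLipschitzOn v (Ici (0 : ℝ)) := isUniformlyLipschitzOn_timeReflection hL hT₁
  -- vorticity, energy and budgets of the reflected flow
  have hcurlv : ∀ s : ℝ, curl (v s) = fun x => -curl (u (T₁ - s)) x := fun s => curl_neg_field (u (T₁ - s))
  have hω₁v : ∫⁻ x, ‖curl (v 0) x‖ₑ < ⊤ := by
    simpa only [hcurlv 0, sub_zero, enorm_neg] using hω₁
  have hunifv : ∀ a b : ℝ, 0 < a → a < b → ∃ M' : ℝ, ∀ τ ∈ Icc a b,
      (Integrable (fun y => ‖v τ y‖ ^ 2) ∧ ∫ y, ‖v τ y‖ ^ 2 ≤ M') ∧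
      (Integrable (fun y => ‖v τ y‖ ^ 3) ∧ ∫ y, ‖v τ y‖ ^ 3 ≤ M') ∧
      (Integrable (fun y => |q τ y| * ‖v τ y‖) ∧ ∫ y, |q τ y| * ‖v τ y‖ ≤ M') := by
    intro a b ha hab
    obtain ⟨M', hM'⟩ := hunif (T₁ - b) (T₁ - a) (by linarith) (by linarith)
    refine ⟨M', fun τ hτ => ?_⟩
    have hτ' : T₁ - τ ∈ Icc (T₁ - b) (T₁ - a) := ⟨by linarith [hτ.2], by linarith [hτ.1]⟩
    simpa only [hvdef, hqdef, norm_neg] using hM' (T₁ - τ) hτ'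
  have hs₀ : 0 < T₁ - t₀ := by linarith
  have hposv : 0 < ∫ y, ‖v (T₁ - t₀) y‖ ^ 2 := by
    simpa only [hvdef, sub_sub_cancel, norm_neg] using hpos
  have hωfinv : ∀ s : ℝ, 0 < s → ∫⁻ x, ‖curl (v s) x‖ₑ ^ 2 < ⊤ := by
    intro s hs
    simpa only [hcurlv s, enorm_neg] using hωfin (T₁ - s) (by linarith)
  have hEnsv : ∫⁻ z in Ioi (0 : ℝ) ×ˢ (univ : Set (EuclideanSpace ℝ (Fin 3))),
      ENNReal.ofReal (frobeniusNormSq (fderiv ℝ (v z.1) z.2)) ≤ (M : ℝ≥0∞) := by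
    have hpt : ∀ z : ℝ × EuclideanSpace ℝ (Fin 3),
        ENNReal.ofReal (frobeniusNormSq (fderiv ℝ (v z.1) z.2)) =
          ENNReal.ofReal (frobeniusNormSq (fderiv ℝ (u (T₁ - z.1)) z.2)) := fun z => by
      rw [hvdef]
      simp only
      rw [fderiv_fun_neg, hfrob]
    calc ∫⁻ z in Ioi (0 : ℝ) ×ˢ (univ : Set (EuclideanSpace ℝ (Fin 3))),
          ENNReal.ofReal (frobeniusNormSq (fderiv ℝ (v z.1) z.2))
        = ∫⁻ z in Ioi (0 : ℝ) ×ˢ (univ : Set (EuclideanSpace ℝ (Fin 3))),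
            (fun w : ℝ × EuclideanSpace ℝ (Fin 3) => ENNReal.ofReal (frobeniusNormSq (fderiv ℝ (u w.1) w.2)))
              (T₁ - z.1, z.2) := lintegral_congr fun z => hpt z
      _ = ∫⁻ w in Iio T₁ ×ˢ (univ : Set (EuclideanSpace ℝ (Fin 3))),
            ENNReal.ofReal (frobeniusNormSq (fderiv ℝ (u w.1) w.2)) :=
          setLIntegral_timeReflection T₁
            (fun w : ℝ × EuclideanSpace ℝ (Fin 3) => ENNReal.ofReal (frobeniusNormSq (fderiv ℝ (u w.1) w.2)))
      _ ≤ ∫⁻ w in Iio (0 : ℝ) ×ˢ (univ : Set (EuclideanSpace ℝ (Fin 3))),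
            ENNReal.ofReal (frobeniusNormSq (fderiv ℝ (u w.1) w.2)) :=
          lintegral_mono_set (Set.prod_mono (Iio_subset_Iio hT₁.le) le_rfl)
      _ ≤ (M : ℝ≥0∞) := hEns
  exact no_relaxing_classicalEuler_of_integrableVorticity hv hLv hω₁v hunifv hs₀ hposv hωfinv hEnsv

end Summit.NavierStokesRegularity.NavierStokesRegularity.Theorems.PowerGaugeEulerLiouville.Negative
end
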